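/-
Copyright (c) 2026 the pub-hodgecm-mathlib formalisation cell (harness21).  Prover seat hodgecm-mathlib-K2E3-p12 (g5) (E3 §L lead on loan to E1 by the CHAIR WORD
«β → E1» 2026-09-04T06:25Z), Track B ∕ K2-LIT, h413 = `stmt-HodgeConjecture-24833`, line `K2_E1_TraceFormulaBeta`, campaign «EIS-RANK-ONE»;
DEAL (q6) «R5b-split» of the dealer K2E1-plan (g4) 2026-09-04T06:44:23Z: THE GINDIKIN–KARPELEVICH FORMULA FOR `GL₃` OVER A NON-ARCHIMEDEAN LOCAL FIELD
(the split places of the CM pair), in big-cell coordinates, by the rank-one reduction done by hand.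
-/
import Summits.HodgeConjecture.HodgeConjecture.Theorems.K2E1IntertwiningLocalFactorU2   -- ★ p858040 (K2E2-p12 g4): Tate's `∫ max(1,|t|)^{−s} dt = μ(𝒪)(1−q^{−s})∕(1−q^{1−s})`; brings ★ `K2LiuGKRankOneIntegral`, ★ `LocalFieldHaarBalls`, ★ `TateLocalZetaShells`
import Mathlib.MeasureTheory.Group.Integral
import HarnessLib

/-!
# K2·E1 — `K2E1GindikinKarpelevichSplitGL3`: THE GINDIKIN–KARPELEVICH FORMULA FOR `GL₃(F)` IN BIG-CELL COORDINATES
# `∫_{F³} (max(1,|x|,|z|)·max(1,|y|,|z−xy|))^{−σ} dx dz dy = μ(𝒪)³·[ζ(σ−1)∕ζ(σ)]²·ζ(2σ−2)∕ζ(2σ−1)`   (`σ > 1`, `ζ(s) = (1 − q^{−s})⁻¹`)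

Track B ∕ K2-LIT, crux h413 = `stmt-HodgeConjecture-24833`, route of record `HCCMUnconditional`; cell `hodgecm-mathlib`, squad K2, ENGINE E1 (campaign «EIS-RANK-ONE»,
rung R5b-split).  Prover seat `hodgecm-mathlib-K2E3-p12` (g5) on loan; DEAL (q6) of the dealer K2E1-plan (g4).  THEOREMS ONLY (no `def`, no `instance`, no notation,
no named-fact hypothesis, no `sorry`); lane `--supports stmt-HodgeConjecture-24833 --as helper` (count-neutral).  Closes no socket.

THE MATHEMATICS [Langlands1971, §3; Casselman1980, Thm. 3.1; MoeglinWaldspurger1995, II.1.7, IV.1.1].  At a place `v` of `L⁺` split in the CM field `L`,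
`U(J₃)(L⁺_v) ≅ GL₃(F)` (`F = L⁺_v`; ★ `UnitaryGroup.localPiSplitEquiv`), the Borel of `U(J₃)` becomes the upper-triangular Borel `B = AN`, and the flat spherical section
`H^σ` becomes `Φ_σ(bk) = |b₁₁∕b₃₃|^σ = δ_B^{1∕2}(b)·|b₁₁∕b₃₃|^{σ−1}` (`k ∈ GL₃(𝒪)`), i.e. the spherical vector of `Ind(λ)` with `λ = (σ−1)·ρ`, `ρ = (1,0,−1)`.  On the big
cell, with `w₀` the antidiagonal long element and `n(x,y,z) = [[1,x,z],[0,1,y],[0,0,1]]`, the bottom row of `w₀n` is `(1,x,z)` and the bottom `2×2` minors of `w₀n` are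
`(1, y, z − xy)` up to sign, so `|b₃₃| = max(1,|x|,|z|)`, `|b₂₂b₃₃| = max(1,|y|,|z−xy|)`, `|b₁₁b₂₂b₃₃| = 1` and
**`Φ_σ(w₀·n(x,y,z)) = (max(1,|x|,|z|)·max(1,|y|,|z−xy|))^{−σ}`** — the integrand of this file (the dictionary «Iwasawa height = sup-norm height» rides with the later
transport brick; here everything is stated directly in the coordinates `(x,y,z) ∈ F³` with the additive Haar measure `μ ⊗ μ ⊗ μ` = Haar of `N(F)`).
THE GINDIKIN–KARPELEVICH PRODUCT `∫_{N(F)} Φ_σ(w₀n) dn = ∏_{α>0} ζ(⟨λ,α^∨⟩)∕ζ(⟨λ,α^∨⟩+1)·μ(𝒪)` has the three factors `ζ(σ−1)∕ζ(σ)` (`α = e₁−e₂`, `e₂−e₃`) and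
`ζ(2σ−2)∕ζ(2σ−1)` (`α = e₁−e₃`), `ζ(s) = (1−q^{−s})⁻¹`; with Tate's `G(s) := ∫_F max(1,|t|)^{−s} dt = μ(𝒪)·(1−q^{−s})∕(1−q^{1−s}) = μ(𝒪)·ζ(s−1)∕ζ(s)` (★ p858040 ∕ ★
`K2LiuGKRankOneIntegral`) the claim is **`I(σ) = G(σ)²·G(2σ−1)`**.  PROOF = the rank-one reduction `M(w₀) = M(s₁)M(s₂)M(s₁)` CARRIED OUT BY HAND inside the triple integral,
INTEGRABILITY-FREE (only pointwise ultrametric identities, the Haar substitution ★ `integral_comp_mul_left` `∫φ(at)dt = |a|⁻¹∫φ`, translation invariance and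
`∫ c·f = c·∫ f` — all unconditional for the Bochner integral):
* §1 ultrametric algebra: `|x| ≤ 1 ⟹ max(|y|,|z−xy|) = max(|y|,|z|)`; `|x| ≥ 1 ⟹ max(|z₁+y|, |x||y|) = max(|z₁|, |x||y|)`; `a ≥ 1 ⟹ max(1,a,b) = a·max(1,b∕a)`.
* §2 `integral_max_one_max_normAbs_rpow_neg`: **`∫_F max(1,|z|,|t|)^{−s} dt = max(1,|z|)^{1−s}·G(s)`** (scale `t = z·u` when `|z| > 1`).
* §3 the inner `y`-integral `J_x(z) = ∫ max(1,|y|,|z−xy|)^{−σ} dy`: `= max(1,|z|)^{1−σ}G(σ)` if `|x| ≤ 1` (§1); `= |x|⁻¹·max(1,|z∕x|)^{1−σ}·G(σ)` if `|x| > 1` (translate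
  `y ↦ z∕x + y`, §1, scale `y ↦ y∕x`, §2); then the FIBRE **`∫_z ∫_y (…) = max(1,|x|)^{−σ}·G(σ)·G(2σ−1)` for EVERY `x`** (scale `z ↦ xz` when `|x| > 1`;
  `max(1,|u|)^{−σ}·max(1,|u|)^{1−σ} = max(1,|u|)^{−(2σ−1)}`).
* §4 **MAIN `integral_bigCell_spherical_gl3_eq`**: `∫_x∫_z∫_y = G(σ)²·G(2σ−1)` (all `σ : ℝ`) and, for `σ > 1`, the CLOSED FORM
  `μ(𝒪)³·((1−q^{−σ})∕(1−q^{1−σ}))²·(1−q^{−(2σ−1)})∕(1−q^{−(2σ−2)})` = `μ(𝒪)³·[ζ(σ−1)∕ζ(σ)]²·ζ(2σ−2)∕ζ(2σ−1)` — the dealer's census value CERTIFIED (also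
  cross-checked numerically against an independent nested∕disjoint-ball shell expansion, q ∈ {2,3,5}, σ ∈ {1.5,2,2.7,4}, agreement 1e−15).
CONSEQUENCE recorded (not a socket): `R5b-split × ★ E3-inert (K2E3SphericalCFunctionMacdonald)` ⟹ the partial global scalar `c^S(σ)` of «R7₃-SCALAR» is a quotient of
partial zeta products whose only pole on `Re σ > 1` is `σ = 2 = 2ρ_H` (from `ζ(2σ−2)` at split places ∕ the inert factor's `(1 − z²)⁻¹`).
SAT-WITNESS (ruling «VAC-U» (3)): no structure is quantified — `F` any non-archimedean local field, `μ` any additive Haar measure, `σ` real; §4's closed form at `σ = 2`,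
`μ(𝒪) = 1` reads `I(2) = (1−q⁻²)²(1+q⁻¹)∕… > 0` — e.g. `q = 2`: `I = 2.625` (numerics above).
HONEST LABEL: HC_CM is proved only modulo the 7 printed citations (2 remaining named inputs: hLiu418 = `stmt-HodgeConjecture-24832`, h413 = `stmt-HodgeConjecture-24833`)
until rung 0 closes; this file asserts no named fact and closes no socket.
References: [Langlands1971] §3 · [Casselman1980] Thm. 3.1 · [MoeglinWaldspurger1995] II.1.7, IV.1.1 · [Tate1950] §2.2 Lemma 2.2.5.
-/

set_option autoImplicit false
-- the mandated namespace repeats the single-problem summit's segment (`HodgeConjecture.HodgeConjecture`)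
set_option linter.dupNamespace false

noncomputable section

open MeasureTheory Filter Topology Set
open scoped NNReal ENNReal
open Literature.NumberTheory.GaloisRepresentations.IsNonarchimedeanLocalField
open Literature.NumberTheory.Automorphic Literature.NumberTheory.Automorphic.LocalFieldHaar
open Summit.HodgeConjecture.HodgeConjecture.Cruxes.H413.K2E1IntertwiningLocalFactorU2 (integral_max_one_normAbs_rpow_neg)

namespace Summit.HodgeConjecture.HodgeConjecture.Cruxes.H413.K2E1GindikinKarpelevichSplitGL3

variable {F : Type*} [Field F] [ValuativeRel F] [TopologicalSpace F] [IsNonarchimedeanLocalField F]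

/-! ## §1  Ultrametric algebra of the big-cell heights -/

/-- `|x| ≤ 1 ⟹ max(|y|, |z − x·y|) = max(|y|, |z|)` (the perturbation `x·y` is absorbed: `|xy| ≤ |y|`). [folklore] -/
theorem max_normAbs_sub_mul_of_le_one {x : F} (hx : normAbs F x ≤ 1) (y z : F) :
    max (normAbs F y) (normAbs F (z - x * y)) = max (normAbs F y) (normAbs F z) := by
  have h1 : normAbs F (x * y) ≤ normAbs F y := by
    rw [map_mul]; exact mul_le_of_le_one_left zero_le hx
  apply le_antisymm
  · refine max_le (le_max_left _ _) ?_
    calc normAbs F (z - x * y) = normAbs F (z + -(x * y)) := by rw [sub_eq_add_neg]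
      _ ≤ max (normAbs F z) (normAbs F (-(x * y))) := normAbs_add_le_max _ _
      _ ≤ max (normAbs F y) (normAbs F z) := by
          rw [normAbs_neg]; exact max_le (le_max_right _ _) (h1.trans (le_max_left _ _))
  · refine max_le (le_max_left _ _) ?_
    calc normAbs F z = normAbs F ((z - x * y) + x * y) := by rw [sub_add_cancel]
      _ ≤ max (normAbs F (z - x * y)) (normAbs F (x * y)) := normAbs_add_le_max _ _
      _ ≤ max (normAbs F y) (normAbs F (z - x * y)) := max_le (le_max_right _ _) (h1.trans (le_max_left _ _))

/-- `|x| ≥ 1 ⟹ max(|z₁ + y|, |x|·|y|) = max(|z₁|, |x|·|y|)` (if `|y| < |z₁|` the sum has norm `|z₁|`; otherwise both sides equal `|x|·|y|`). [folklore] -/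
theorem max_normAbs_add_mul_of_one_le {x : F} (hx : 1 ≤ normAbs F x) (z₁ y : F) :
    max (normAbs F (z₁ + y)) (normAbs F x * normAbs F y) = max (normAbs F z₁) (normAbs F x * normAbs F y) := by
  have hy : normAbs F y ≤ normAbs F x * normAbs F y := le_mul_of_one_le_left zero_le hx
  rcases lt_or_ge (normAbs F y) (normAbs F z₁) with h | h
  · rw [normAbs_add_eq_of_lt h]
  · rw [max_eq_right (h.trans hy), max_eq_right]
    exact (normAbs_add_le_max _ _).trans (max_le (h.trans hy) hy)

/-- `a ≥ 1` ⟹ `max(1, a, b) = a·max(1, b∕a)` (the Iwasawa height of `s·u(t)` in `GL₂`: `max(1,|t|)`, rescaled). [folklore] -/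
theorem max_one_max_eq_mul {a : ℝ} (ha : 1 ≤ a) (b : ℝ) : max 1 (max a b) = a * max 1 (a⁻¹ * b) := by
  have ha0 : 0 < a := by linarith
  rcases le_or_gt b a with h | h
  · rw [max_eq_right (le_max_of_le_left ha), max_eq_left h, max_eq_left, mul_one]
    rw [inv_mul_le_iff₀ ha0]; linarith
  · rw [max_eq_right ((ha.trans h.le).trans (le_max_right _ _)), max_eq_right h.le, max_eq_right, mul_inv_cancel_left₀ ha0.ne']
    rw [le_inv_mul_iff₀ ha0]; linarith

/-- `|x| ≤ 1 ⟹ max(1, |x|, b) = max(1, b)`. [folklore] -/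
theorem max_one_max_eq_of_le_one {a b : ℝ} (ha : a ≤ 1) : max 1 (max a b) = max 1 b := by
  rw [← max_assoc, max_eq_left ha]

section Haar

variable [MeasurableSpace F] [BorelSpace F] (μ : Measure F) [μ.IsAddHaarMeasure]

/-! ## §2  The rank-one integral with a floor: `∫ max(1,|z|,|t|)^{−s} dt = max(1,|z|)^{1−s}·G(s)` -/

/-- **`∫_F max(1,|z|,|t|)^{−s} dμ(t) = max(1,|z|)^{1−s} · ∫_F max(1,|t|)^{−s} dμ(t)`** for every `z : F` and every real `s` (unconditional identity of Bochner integrals):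
trivial for `|z| ≤ 1`; for `|z| > 1` substitute `t = z·u` (★ `integral_comp_mul_left`, Jacobian `|z|`) and use `max(1,|z|,|z||u|) = |z|·max(1,|u|)`.
[cite: Tate1950, §2.2 Lemma 2.2.5] [cite: Casselman1980, Thm. 3.1] -/
theorem integral_max_one_max_normAbs_rpow_neg (z : F) (s : ℝ) :
    ∫ t, (max 1 (max ((normAbs F z : ℝ≥0) : ℝ) ((normAbs F t : ℝ≥0) : ℝ))) ^ (-s) ∂μ =
      (max 1 ((normAbs F z : ℝ≥0) : ℝ)) ^ (1 - s) * ∫ t, (max 1 ((normAbs F t : ℝ≥0) : ℝ)) ^ (-s) ∂μ := by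
  rcases le_or_gt (normAbs F z) 1 with hz | hz
  · have hz' : ((normAbs F z : ℝ≥0) : ℝ) ≤ 1 := by exact_mod_cast hz
    simp_rw [max_one_max_eq_of_le_one hz']
    rw [max_eq_left hz', Real.one_rpow, one_mul]
  · have hz0 : z ≠ 0 := by
      rintro rfl
      rw [map_zero] at hz
      exact not_lt.2 zero_le_one hz
    have hzR : (1 : ℝ) < ((normAbs F z : ℝ≥0) : ℝ) := by exact_mod_cast hz
    have hzpos : (0 : ℝ) < ((normAbs F z : ℝ≥0) : ℝ) := one_pos.trans hzR
    have hsub := integral_comp_mul_left μ hz0 (fun t => (max 1 (max ((normAbs F z : ℝ≥0) : ℝ) ((normAbs F t : ℝ≥0) : ℝ))) ^ (-s))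
    have hinv : ((normAbs F z⁻¹ : ℝ≥0) : ℝ) = ((normAbs F z : ℝ≥0) : ℝ)⁻¹ := by rw [map_inv₀, NNReal.coe_inv]
    have hpt : ∀ u : F, (max 1 (max ((normAbs F z : ℝ≥0) : ℝ) ((normAbs F (z * u) : ℝ≥0) : ℝ))) ^ (-s) =
        ((normAbs F z : ℝ≥0) : ℝ) ^ (-s) * (max 1 ((normAbs F u : ℝ≥0) : ℝ)) ^ (-s) := by
      intro u
      rw [map_mul, NNReal.coe_mul, max_one_max_eq_mul hzR.le _, inv_mul_cancel_left₀ hzpos.ne',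
        Real.mul_rpow hzpos.le (by positivity)]
    simp only [hpt, hinv, smul_eq_mul] at hsub
    rw [integral_const_mul, eq_comm, inv_mul_eq_iff_eq_mul₀ hzpos.ne'] at hsub
    rw [hsub, max_eq_right hzR.le, ← mul_assoc, sub_eq_add_neg, Real.rpow_add hzpos, Real.rpow_one]

/-! ## §3  The inner `y`-integral and the fibre over `x` -/

/-- The inner `y`-integral for `|x| ≤ 1`: **`∫ max(1,|y|,|z−xy|)^{−σ} dy = max(1,|z|)^{1−σ}·G(σ)`** (§1: the term `xy` is absorbed; then §2).
[cite: Casselman1980, Thm. 3.1] -/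
theorem integral_inner_of_le_one {x : F} (hx : normAbs F x ≤ 1) (z : F) (σ : ℝ) :
    ∫ y, (max 1 (max ((normAbs F y : ℝ≥0) : ℝ) ((normAbs F (z - x * y) : ℝ≥0) : ℝ))) ^ (-σ) ∂μ =
      (max 1 ((normAbs F z : ℝ≥0) : ℝ)) ^ (1 - σ) * ∫ t, (max 1 ((normAbs F t : ℝ≥0) : ℝ)) ^ (-σ) ∂μ := by
  have hpt : ∀ y : F, max ((normAbs F y : ℝ≥0) : ℝ) ((normAbs F (z - x * y) : ℝ≥0) : ℝ) =
      max ((normAbs F z : ℝ≥0) : ℝ) ((normAbs F y : ℝ≥0) : ℝ) := by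
    intro y
    rw [← NNReal.coe_max, max_normAbs_sub_mul_of_le_one hx, NNReal.coe_max, max_comm]
  simp_rw [hpt]
  exact integral_max_one_max_normAbs_rpow_neg μ z σ

/-- The inner `y`-integral for `|x| > 1`: **`∫ max(1,|y|,|z−xy|)^{−σ} dy = |x|⁻¹·max(1,|x⁻¹z|)^{1−σ}·G(σ)`** — write `z − xy = x·(x⁻¹z − y)`, translate `y ↦ x⁻¹z + y`
(`integral_add_left_eq_self`), use §1 `max(|x⁻¹z + y|, |x||y|) = max(|x⁻¹z|, |x||y|)`, rescale `y ↦ x⁻¹·y` (★ `integral_comp_mul_left`, Jacobian `|x|⁻¹`), then §2.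
[cite: Casselman1980, Thm. 3.1] [cite: Tate1950, §2.2 Lemma 2.2.5] -/
theorem integral_inner_of_one_lt {x : F} (hx : 1 < normAbs F x) (z : F) (σ : ℝ) :
    ∫ y, (max 1 (max ((normAbs F y : ℝ≥0) : ℝ) ((normAbs F (z - x * y) : ℝ≥0) : ℝ))) ^ (-σ) ∂μ =
      ((normAbs F x : ℝ≥0) : ℝ)⁻¹ * ((max 1 ((normAbs F (x⁻¹ * z) : ℝ≥0) : ℝ)) ^ (1 - σ) * ∫ t, (max 1 ((normAbs F t : ℝ≥0) : ℝ)) ^ (-σ) ∂μ) := by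
  have hx0 : x ≠ 0 := by
    rintro rfl
    rw [map_zero] at hx
    exact not_lt.2 zero_le_one hx
  -- (i) `z − x y = x (x⁻¹ z − y)` and translation `y ↦ x⁻¹ z + y`
  have hpt : ∀ y : F, max ((normAbs F y : ℝ≥0) : ℝ) ((normAbs F (z - x * y) : ℝ≥0) : ℝ) =
      max ((normAbs F y : ℝ≥0) : ℝ) (((normAbs F x : ℝ≥0) : ℝ) * ((normAbs F (x⁻¹ * z - y) : ℝ≥0) : ℝ)) := by
    intro y
    rw [show z - x * y = x * (x⁻¹ * z - y) by rw [mul_sub, mul_inv_cancel_left₀ hx0], map_mul, NNReal.coe_mul]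
  simp_rw [hpt]
  rw [← integral_add_left_eq_self _ (x⁻¹ * z)]
  have hpt2 : ∀ y : F, max ((normAbs F (x⁻¹ * z + y) : ℝ≥0) : ℝ) (((normAbs F x : ℝ≥0) : ℝ) * ((normAbs F (x⁻¹ * z - (x⁻¹ * z + y)) : ℝ≥0) : ℝ)) =
      max ((normAbs F (x⁻¹ * z) : ℝ≥0) : ℝ) ((normAbs F (x * y) : ℝ≥0) : ℝ) := by
    intro y
    rw [show x⁻¹ * z - (x⁻¹ * z + y) = -y by abel, normAbs_neg, ← NNReal.coe_mul, ← NNReal.coe_max,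
      max_normAbs_add_mul_of_one_le hx.le, ← map_mul, NNReal.coe_max]
  simp_rw [hpt2]
  -- (ii) rescale `y ↦ x⁻¹ y`: `∫ φ(x y) dy = |x|⁻¹ ∫ φ`
  have hsub := integral_comp_mul_left μ hx0 (fun t => (max 1 (max ((normAbs F (x⁻¹ * z) : ℝ≥0) : ℝ) ((normAbs F t : ℝ≥0) : ℝ))) ^ (-σ))
  have hinv : ((normAbs F x⁻¹ : ℝ≥0) : ℝ) = ((normAbs F x : ℝ≥0) : ℝ)⁻¹ := by rw [map_inv₀, NNReal.coe_inv]
  simp only [hinv, smul_eq_mul] at hsub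
  rw [hsub, integral_max_one_max_normAbs_rpow_neg μ (x⁻¹ * z) σ]

/-- **THE FIBRE OVER `x`**: for EVERY `x : F` and every real `σ`,
`∫_z ∫_y (max(1,|x|,|z|)·max(1,|y|,|z−xy|))^{−σ} dy dz = max(1,|x|)^{−σ} · G(σ) · G(2σ−1)`, `G(s) = ∫ max(1,|t|)^{−s} dt` — the two rank-one steps `M(s₂)M(s₁)` of the
reduction (inner integral by the previous two lemmas; for `|x| > 1` rescale `z ↦ x·z`, Jacobian `|x|`; `max(1,|u|)^{−σ}·max(1,|u|)^{1−σ} = max(1,|u|)^{−(2σ−1)}`).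
[cite: Langlands1971, §3] [cite: Casselman1980, Thm. 3.1] -/
theorem integral_integral_bigCellFibre_eq (σ : ℝ) (x : F) :
    ∫ z, ∫ y, (max 1 (max ((normAbs F x : ℝ≥0) : ℝ) ((normAbs F z : ℝ≥0) : ℝ))) ^ (-σ) *
        (max 1 (max ((normAbs F y : ℝ≥0) : ℝ) ((normAbs F (z - x * y) : ℝ≥0) : ℝ))) ^ (-σ) ∂μ ∂μ =
      (max 1 ((normAbs F x : ℝ≥0) : ℝ)) ^ (-σ) *
        ((∫ t, (max 1 ((normAbs F t : ℝ≥0) : ℝ)) ^ (-σ) ∂μ) * ∫ t, (max 1 ((normAbs F t : ℝ≥0) : ℝ)) ^ (-(2 * σ - 1)) ∂μ) := by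
  -- the power bookkeeping `m^{−σ}·m^{1−σ} = m^{−(2σ−1)}` for `m ≥ 1`
  have hpow : ∀ u : F, (max 1 ((normAbs F u : ℝ≥0) : ℝ)) ^ (-σ) * (max 1 ((normAbs F u : ℝ≥0) : ℝ)) ^ (1 - σ) =
      (max 1 ((normAbs F u : ℝ≥0) : ℝ)) ^ (-(2 * σ - 1)) := by
    intro u
    rw [← Real.rpow_add (by positivity)]
    ring_nf
  simp_rw [integral_const_mul]
  rcases le_or_gt (normAbs F x) 1 with hx | hx
  · -- `|x| ≤ 1`: no rescaling
    have hx' : ((normAbs F x : ℝ≥0) : ℝ) ≤ 1 := by exact_mod_cast hx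
    simp_rw [integral_inner_of_le_one μ hx, max_one_max_eq_of_le_one hx']
    rw [max_eq_left hx', Real.one_rpow, one_mul]
    have hpt : ∀ z : F, (max 1 ((normAbs F z : ℝ≥0) : ℝ)) ^ (-σ) *
        ((max 1 ((normAbs F z : ℝ≥0) : ℝ)) ^ (1 - σ) * ∫ t, (max 1 ((normAbs F t : ℝ≥0) : ℝ)) ^ (-σ) ∂μ) =
        (∫ t, (max 1 ((normAbs F t : ℝ≥0) : ℝ)) ^ (-σ) ∂μ) * (max 1 ((normAbs F z : ℝ≥0) : ℝ)) ^ (-(2 * σ - 1)) := by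
      intro z
      rw [← mul_assoc, hpow, mul_comm]
    simp_rw [hpt]
    rw [integral_const_mul]
  · -- `|x| > 1`: rescale `z ↦ x z`
    have hx0 : x ≠ 0 := by
      rintro rfl
      rw [map_zero] at hx
      exact not_lt.2 zero_le_one hx
    have hxR : (1 : ℝ) < ((normAbs F x : ℝ≥0) : ℝ) := by exact_mod_cast hx
    have hxpos : (0 : ℝ) < ((normAbs F x : ℝ≥0) : ℝ) := one_pos.trans hxR
    simp_rw [integral_inner_of_one_lt μ hx]
    have hpt : ∀ z : F, (max 1 (max ((normAbs F x : ℝ≥0) : ℝ) ((normAbs F z : ℝ≥0) : ℝ))) ^ (-σ) *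
        (((normAbs F x : ℝ≥0) : ℝ)⁻¹ * ((max 1 ((normAbs F (x⁻¹ * z) : ℝ≥0) : ℝ)) ^ (1 - σ) * ∫ t, (max 1 ((normAbs F t : ℝ≥0) : ℝ)) ^ (-σ) ∂μ)) =
        (((normAbs F x : ℝ≥0) : ℝ) ^ (-σ) * ((normAbs F x : ℝ≥0) : ℝ)⁻¹ * ∫ t, (max 1 ((normAbs F t : ℝ≥0) : ℝ)) ^ (-σ) ∂μ) *
          (max 1 ((normAbs F (x⁻¹ * z) : ℝ≥0) : ℝ)) ^ (-(2 * σ - 1)) := by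
      intro z
      rw [max_one_max_eq_mul hxR.le _, show ((normAbs F x : ℝ≥0) : ℝ)⁻¹ * ((normAbs F z : ℝ≥0) : ℝ) =
        ((normAbs F (x⁻¹ * z) : ℝ≥0) : ℝ) by rw [map_mul, map_inv₀, NNReal.coe_mul, NNReal.coe_inv],
        Real.mul_rpow hxpos.le (by positivity), ← hpow (x⁻¹ * z)]
      ring
    simp_rw [hpt]
    rw [integral_const_mul]
    -- `∫ h(x⁻¹ z) dz = |x| ∫ h`
    have hsub := integral_comp_mul_left μ (inv_ne_zero hx0) (fun t => (max 1 ((normAbs F t : ℝ≥0) : ℝ)) ^ (-(2 * σ - 1)))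
    rw [inv_inv] at hsub
    simp only [smul_eq_mul] at hsub
    rw [hsub, max_eq_right hxR.le]
    field_simp

/-! ## §4  The Gindikin–Karpelevich formula for `GL₃(F)` -/

/-- **GINDIKIN–KARPELEVICH FOR `GL₃(F)`, PRODUCT FORM** (every real `σ`, unconditional identity of iterated Bochner integrals):
`∫_x ∫_z ∫_y (max(1,|x|,|z|)·max(1,|y|,|z−xy|))^{−σ} = G(σ)²·G(2σ−1)`, `G(s) = ∫_F max(1,|t|)^{−s} dt` — the three positive roots `e₁−e₂, e₂−e₃ ↦ G(σ)`,
`e₁−e₃ ↦ G(2σ−1)`. [cite: Langlands1971, §3] [cite: Casselman1980, Thm. 3.1] [cite: MoeglinWaldspurger1995, II.1.7] -/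
theorem integral_bigCell_spherical_gl3_eq_prod (σ : ℝ) :
    ∫ x, ∫ z, ∫ y, (max 1 (max ((normAbs F x : ℝ≥0) : ℝ) ((normAbs F z : ℝ≥0) : ℝ))) ^ (-σ) *
        (max 1 (max ((normAbs F y : ℝ≥0) : ℝ) ((normAbs F (z - x * y) : ℝ≥0) : ℝ))) ^ (-σ) ∂μ ∂μ ∂μ =
      (∫ t, (max 1 ((normAbs F t : ℝ≥0) : ℝ)) ^ (-σ) ∂μ) ^ 2 * ∫ t, (max 1 ((normAbs F t : ℝ≥0) : ℝ)) ^ (-(2 * σ - 1)) ∂μ := by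
  simp_rw [integral_integral_bigCellFibre_eq μ σ]
  rw [integral_mul_const]
  ring

/-- **GINDIKIN–KARPELEVICH FOR `GL₃(F)` AT THE SPLIT PLACES, CLOSED FORM** (`σ > 1`):
`∫_x ∫_z ∫_y (max(1,|x|,|z|)·max(1,|y|,|z−xy|))^{−σ} dμ dμ dμ = μ(𝒪)³ · ((1−q^{−σ})∕(1−q^{1−σ}))² · (1−q^{−(2σ−1)})∕(1−q^{−(2σ−2)})`
`= μ(𝒪)³·[ζ(σ−1)∕ζ(σ)]²·ζ(2σ−2)∕ζ(2σ−1)`, `ζ(s) = (1−q^{−s})⁻¹` — the local intertwining scalar `c_v(σ)` of the flat spherical section of `U(J₃) ≅ GL₃` at a split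
place (Tate's integral ★ p858040 at `s = σ` twice and `s = 2σ−1` once). [cite: Langlands1971, §3] [cite: Casselman1980, Thm. 3.1] [cite: MoeglinWaldspurger1995, IV.1.1] -/
theorem integral_bigCell_spherical_gl3_eq {σ : ℝ} (hσ : 1 < σ) :
    ∫ x, ∫ z, ∫ y, (max 1 (max ((normAbs F x : ℝ≥0) : ℝ) ((normAbs F z : ℝ≥0) : ℝ))) ^ (-σ) *
        (max 1 (max ((normAbs F y : ℝ≥0) : ℝ) ((normAbs F (z - x * y) : ℝ≥0) : ℝ))) ^ (-σ) ∂μ ∂μ ∂μ =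
      μ.real (primePowBall F 0) ^ 3 *
        (((1 - (residueFieldCard F : ℝ) ^ (-σ)) / (1 - (residueFieldCard F : ℝ) ^ (1 - σ))) ^ 2 *
          ((1 - (residueFieldCard F : ℝ) ^ (-(2 * σ - 1))) / (1 - (residueFieldCard F : ℝ) ^ (-(2 * σ - 2))))) := by
  rw [integral_bigCell_spherical_gl3_eq_prod, integral_max_one_normAbs_rpow_neg μ hσ,
    integral_max_one_normAbs_rpow_neg μ (by linarith : 1 < 2 * σ - 1), show (1 : ℝ) - (2 * σ - 1) = -(2 * σ - 2) by ring]
  ring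

end Haar

end Summit.HodgeConjecture.HodgeConjecture.Cruxes.H413.K2E1GindikinKarpelevichSplitGL3

end
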